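import Summits.ResolutionOfSingularities.ResolutionOfSingularities.Theorems.EquisingularLiftEquisingularLiftNatFirstOrderLineStrictTransform
import HarnessLib

/-!
# [OURS · specimen criterion] THE WHITNEY-UMBRELLA CHART `z₀² − u·z₁²` IS A FIRST-ORDER LINE IN EVERY CHARACTERISTIC — the `u`-derivative at work
# (cruxes `Theses.EquisingularLift.EquisingularLiftNat` / `…NatThree`, stmt-ResolutionOfSingularities-20038 / -20148)

[OURS · leafhand-res-equisingularlift-9 g0, 2026-08-31; cell `pub/decomp-res`] AI-produced, weaker than expert review; NOT a statement of any manuscript;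
nothing here proves resolution of singularities.  DEF-FREE helper; no `sorry`; standard axioms; ZERO named hypotheses.

The chart of the Whitney umbrella / pinch point along its double line is `f = z₀² − u·z₁² (+ higher)` over `R = K[u]`: the transversal type `z₀² − u z₁²` is
an ordinary node for `u ≠ 0` and DEGENERATES at `u = 0`; in characteristic `2` both `z`-partials of the tangent cone vanish identically.  Nevertheless the
first-order criterion along the line (FO-L) of ✓ `FirstOrderLine.exists_strictTransform` holds in EVERY characteristic, thanks to the `u`-derivative
`∂_u(z₀² − u z₁²) = −z₁²`:

* `FirstOrderLine.uDeriv_whitney` — `ρ∂_{inr 0}ρ⁻¹ (z₀² − C(u)·z₁²) = −z₁²` (`ρ = sumAlgEquiv K (Fin 2) (Fin 1)`);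
* ★ `FirstOrderLine.firstOrderLine_whitney` — (FO-L) for `Φ = z₀² − C(u)·z₁²` and ANY next form `Ψ₁`: a prime containing `Φ` and `−z₁²` contains `z₁`,
  then `z₀² = Φ + C(u)z₁²`, hence `z₀`.

References: [Hartshorne1977, I Ex. 5.8]; H. Whitney's umbrella `x₀x₁² − x₂²x₃` (pinch point) — index only.
-/

set_option linter.dupNamespace false -- mandated namespace `Summit.<Summit>.<Problem>` of this single-conjunct summit

noncomputable section

open MvPolynomial

namespace Summit.ResolutionOfSingularities.ResolutionOfSingularities.Cruxes.EquisingularLiftNat.Sections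

namespace FirstOrderLine

variable (K : Type) [Field K]

/-- **`∂_u (z₀² − u·z₁²) = −z₁²`** through `ρ = sumAlgEquiv K (Fin 2) (Fin 1)` (algebra-isomorphism form). [folklore] -/
theorem uDeriv_whitney' :
    sumAlgEquiv K (Fin 2) (Fin 1) (pderiv (Sum.inr 0) ((sumAlgEquiv K (Fin 2) (Fin 1)).symm
      (X 0 ^ 2 - C (X 0) * X 1 ^ 2 : MvPolynomial (Fin 2) (MvPolynomial (Fin 1) K)))) = -(X 1 ^ 2) := by
  have hsq : ∀ j : Fin 2, sumAlgEquiv K (Fin 2) (Fin 1) (pderiv (Sum.inr 0) ((sumAlgEquiv K (Fin 2) (Fin 1)).symm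
      ((X j : MvPolynomial (Fin 2) (MvPolynomial (Fin 1) K)) ^ 2))) = 0 := fun j => by
    rw [pow_two, uDeriv_mul, uDeriv_X, zero_mul, mul_zero, add_zero]
  rw [map_sub, map_sub, map_sub, hsq 0, uDeriv_mul, uDeriv_C, pderiv_X_self, map_one, one_mul, hsq 1, mul_zero, add_zero, zero_sub]

/-- **`∂_u (z₀² − u·z₁²) = −z₁²`** in the ring-isomorphism form used by ✓ `FirstOrderLine.exists_strictTransform`. [folklore] -/
theorem uDeriv_whitney :
    (sumAlgEquiv K (Fin 2) (Fin 1)).toRingEquiv (pderiv (Sum.inr 0) ((sumAlgEquiv K (Fin 2) (Fin 1)).toRingEquiv.symm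
      (X 0 ^ 2 - C (X 0) * X 1 ^ 2 : MvPolynomial (Fin 2) (MvPolynomial (Fin 1) K)))) = -(X 1 ^ 2) :=
  uDeriv_whitney' K

/-- ★ **The Whitney-umbrella chart is a first-order line in EVERY characteristic**: for `Φ = z₀² − C(u)·z₁²` over `R = K[u]` and ANY next form `Ψ₁`,
every prime of `R[z₀, z₁]` containing `Φ` and all `ρ∂_vρ⁻¹Φ` (`ρ = sumAlgEquiv`) contains `z₀` and `z₁` — the `u`-derivative `−z₁²` gives `z₁`, then
`z₀² = Φ + C(u)z₁²` gives `z₀` (the `z`-partials `2z₀`, `−2C(u)z₁` are not needed, so characteristic `2` is included).  This is the hypothesis (FO-L) of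
✓ `FirstOrderLine.exists_strictTransform` / ✓ `FirstOrderLine.elNatAt_firstOrderLine` at such a chart. [folklore] -/
theorem firstOrderLine_whitney (Ψ₁ : MvPolynomial (Fin 2) (MvPolynomial (Fin 1) K)) (P : Ideal (MvPolynomial (Fin 2) (MvPolynomial (Fin 1) K)))
    (hP : P.IsPrime) (hΦ : (X 0 ^ 2 - C (X 0) * X 1 ^ 2 : MvPolynomial (Fin 2) (MvPolynomial (Fin 1) K)) ∈ P)
    (hD : ∀ v : Fin 2 ⊕ Fin 1, (sumAlgEquiv K (Fin 2) (Fin 1)).toRingEquiv (pderiv v ((sumAlgEquiv K (Fin 2) (Fin 1)).toRingEquiv.symm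
      (X 0 ^ 2 - C (X 0) * X 1 ^ 2 : MvPolynomial (Fin 2) (MvPolynomial (Fin 1) K)))) ∈ P)
    (_hΨ : Ψ₁ ∈ P) (j : Fin 2) : (X j : MvPolynomial (Fin 2) (MvPolynomial (Fin 1) K)) ∈ P := by
  have h1 : (X 1 : MvPolynomial (Fin 2) (MvPolynomial (Fin 1) K)) ∈ P := by
    have h := hD (Sum.inr 0)
    rw [uDeriv_whitney, Ideal.neg_mem_iff] at h
    exact hP.mem_of_pow_mem 2 h
  have h0 : (X 0 : MvPolynomial (Fin 2) (MvPolynomial (Fin 1) K)) ∈ P := by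
    have h : (X 0 ^ 2 : MvPolynomial (Fin 2) (MvPolynomial (Fin 1) K)) = (X 0 ^ 2 - C (X 0) * X 1 ^ 2) + C (X 0) * X 1 ^ 2 := by ring
    refine hP.mem_of_pow_mem 2 ?_
    rw [h]
    exact P.add_mem hΦ (P.mul_mem_left _ (P.pow_mem_of_mem h1 2 two_pos))
  fin_cases j
  · exact h0
  · exact h1

end FirstOrderLine

end Summit.ResolutionOfSingularities.ResolutionOfSingularities.Cruxes.EquisingularLiftNat.Sections

end
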